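import Literature.MathematicalPhysics.QuantumFieldTheory.Balaban1983to89.T3AlphaInputsACSchemas
import Literature.MathematicalPhysics.QuantumFieldTheory.Balaban1983to89.T3AlphaPolymerSocket
import HarnessLib

/-!
# `Balaban1983to89.T3AlphaInputsACTwoRun` — rung R3, crux «FluctuationComparisonRegPr» (stmt-QuantumFields-19201), owner ruling g15-№2 (2026-08-26
# 17:19Z/17:26Z, typing assignment to the socket pen ★ym-ust-19201-p2): the TWO-RUN clauses delivered WITH a constructed `AlphaDataT3` — matched
# localisation domains (`T3AlphaPolymerSocket.LocMatched`, reused), the per-polymer cut-off comparison AT THE CANONICAL MATCHED BACKGROUND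
# (`PolymerCauchyBgAt`, m-free, exponents as parameters), the real-Lipschitz dependence of the localised terms on the background (`PtermLipschitz`,
# [Balaban1987RG1] (1.11)–(1.18)), the bundle `TwoRun`; and the route-level minimiser two-cut-off closeness `MinimiserCauchyAt` (e1) —
# all HYPOTHESIS SCHEMAS (never asserted)

WHY (owner ruling g15-№2 (ii)(A), ★p1 g1's rigidity p452861): a cut «∀ good D, Rep → Cauchy» unloads nothing onto the α stub, because per-run schemas
constrain no cross-run VALUES; the two-run content must be delivered WITH the constructed `D` (stub `stub_alphaTwoRunOfLane`: `∃ D C68,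
T3AlphaInputsACSchemas.AlphaInputsT3AC D b₀ p₀ ε₀ C68 ∧ TwoRun D b₀ p₀ a`) and the minimiser comparison (e1) separately (`stub_minimiserCauchy`), so that
the remaining stub `stub_levelCauchyOfSchemas` is honest bookkeeping: per polymer, `|Pterm′(refine Y)(Umin′) − Pterm Y (Umin) − c| ≤ [PolymerCauchyBgAt at
the matched background `coarsen Umin′`] + [PtermLipschitz × dist(coarsen Umin′, Umin) = e1]`, then `levelCauchyAt_of_polymerwise` (p458947) →
`cauchyAtHeights_of_levelwise` (p456396) → `logComparisonRegPr_of_exists_data`-shape glue (p452026) → the registered stub-3 text.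

CONVENTIONS FIXED HERE (to be confirmed by the constructing prover; one erratum exchange allowed): (a) backgrounds are compared at the FINE scale of run
`K` through `coarsenField F K U′ := e₀((blockAvg ℰp).avg U′)` (one (0.4) step of run `K+1`'s fine field, then the level identification — the matching
of ★p2's one-tower normal form `LogComparisonOneTower.descendTo_succ_eq`); (b) distances are GAUGE-ORBIT sup-distances `orbitDistOn S U U′ :=
inf_u sup_{b ∈ S} dist1((U^u)(b)·U′(b)⁻¹)` on bond sets (so every schema is compatible with `GaugeInv26`); (c) the analyticity radius of a level-`i` term
is ABSOLUTE in print's ξ-scaled variables ([Balaban1987RG1] (1.13): `U′ = exp iξ𝐀′`, `|𝐀′| < α₁`, `ξ = L^{−i}`), i.e. `α₁·L^{−i}` in fine group distance —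
hence the factor `L^i·orbitDistOn …/α₁` in `PtermLipschitz`; (d) exponents (`a`, `a₁`, `κ₁`) are PARAMETERS of the schemas, never ∃-bound inside
(QUANTIFIER CONTRACT: they decide `m₀` and are bound before `m`); multiplicative constants are parameters too, ∃-bound only in the bundle `TwoRun`.

NON-VACUITY SELF-TEST (director's rule; informal, each clause bites): the junk datum of finding 0364c67c41f82510 (`Adm := ∅, enl := univ, Pterm :=
(log ρ + bg)∘avg^j`) fails `AlphaInputsT3AC` by `UminTrivIsRegMinimiser`/`AdmOnSmall`; `Pterm := 0` fails `RepAtHeights` (ρ_res is not within `±Rm` of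
`e^{−bg−E}`); a datum whose run-`(K+1)` terms are Bałaban's plus a gauge-invariant local perturbation of full `TermSize` fails `PolymerCauchyBgAt` (no
`L^{−a(K−1−j)}` decay); a datum with `Pterm` non-Lipschitz in the background fails `PtermLipschitz`.

References: T. Bałaban, CMP 109 (1987) 249–301 [Balaban1987RG1] ((1.11)–(1.18) pp.262–263); CMP 102 (1985) 255–275 [Balaban1985UV3] ((24)–(25) p.262,
(43)–(46) pp.266–267); CMP 102 (1985) 277–309 [Balaban1985Variational] (Thm 1 (8)–(10) p.279); C. King, CMP 102 (1986) 649–677 [King1986] (Props 3.8–3.10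
pp.664–669, §3.4–3.5).
-/

noncomputable section

open MeasureTheory
open Literature.MathematicalPhysics.QuantumFieldTheory.Balaban1983to89.T3ContinuumYM3Torus
open Literature.MathematicalPhysics.QuantumFieldTheory.Balaban1983to89.T3UnitLawDensityEML (ℰp)
open Literature.MathematicalPhysics.QuantumFieldTheory.Balaban1983to89.T3UnitScaleTilt
open Literature.MathematicalPhysics.QuantumFieldTheory.Balaban1983to89.T3LevelShift
open Literature.MathematicalPhysics.QuantumFieldTheory.Balaban1983to89.T3PrintedRegularMinimiser
open Literature.MathematicalPhysics.QuantumFieldTheory.Balaban1983to89.T3AlphaInputsAC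
open Literature.MathematicalPhysics.QuantumFieldTheory.Balaban1983to89.T3AlphaPolymerSocket
open Literature.MathematicalPhysics.QuantumFieldTheory.Balaban1983to89.B10Eq38TorusDomains (plaqsIn)
open Literature.MathematicalPhysics.QuantumFieldTheory.Balaban1983to89.B10Eq42TorusConstraint (bondsIn)

namespace Literature.MathematicalPhysics.QuantumFieldTheory.Balaban1983to89.T3AlphaInputsACTwoRun

/-! ## §1 Geometry and distances across the two cut-offs -/

section Geometry

variable (F : T3Family) (K : ℕ)

/-- **THE CANONICAL MATCHED BACKGROUND**: run `K+1`'s fine configuration averaged ONCE by the route's (0.4)/EML block averaging and read on run `K`'s finest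
lattice (the matching of the one-tower normal form; [Balaban1987RG1] (0.4)/(0.11)). [cite: Balaban1987RG1, (0.4) p.253] -/
def coarsenField (U' : GaugeField (F.P (K + 1)) 0 (Matrix.specialUnitaryGroup (Fin 2) ℂ)) :
    GaugeField (F.P K) 0 (Matrix.specialUnitaryGroup (Fin 2) ℂ) :=
  fieldShift (F.sitesPerDir_eq (m := F.m) (K := K) (j := 0) (m' := F.m) (K' := K + 1) (j' := 1) rfl)
    ((BlockAveraging.blockAvg (P := F.P (K + 1)) (j := 0) ℰp).avg U')

variable {K}

/-- **GAUGE-ORBIT SUP-DISTANCE ON A BOND SET**: `inf over gauge transformations u of the sup over b ∈ S of dist(U^u(b)·U′(b)⁻¹, 1)` (`0` witnesses the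
set is bounded below; on `SU(2)` `dist1 ≤ 2`, so the infimum is over a non-empty set).  Invariant under gauge transformations of either argument,
as the localised terms are ((26) p.263). [cite: Balaban1985Averaging, (8) p.19] -/
def orbitDistOn (S : Set (PBond (F.P K) 0)) (U U' : GaugeField (F.P K) 0 (Matrix.specialUnitaryGroup (Fin 2) ℂ)) : ℝ :=
  sInf {d : ℝ | 0 ≤ d ∧ ∃ u : GaugeTransf (F.P K) 0 (Matrix.specialUnitaryGroup (Fin 2) ℂ),
    ∀ b ∈ S, GaugeGroup.dist1 (GaugeField.gaugeAct u U b * (U' b)⁻¹) ≤ d}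

end Geometry

/-! ## §2 The two-run schemas on a datum `D` (hypothesis schemas over the exposed data; never asserted) -/

section Schemas

variable {F : T3Family} {γ : ℝ} (D : AlphaDataT3 F γ) (b₀ p₀ : ℝ)

/-- **THE CUT-OFF COMPARISON OF THE LOCALISED TERMS AT THE CANONICAL MATCHED BACKGROUND** (hypothesis schema, never asserted; m-FREE; exponent `a`,
decay rate `κ₁`, constant `C` are PARAMETERS): there are background-independent shifts `c K n j Y` such that for every cut-off `K`, height `n ≤ K`, step
`j < K − n`, every fine background `U′` of run `K+1` in the regular window of height `n` ((68): `|U′(∂q) − 1| ≤ C68·θBal(n)·L^{−2(K+1−n)}`), and every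
run-`K` localisation domain `Y` of level `1+j` at the trivial history,
`|Pterm (K+1) (2+j) (refineSet F K Y) U′ − Pterm K (1+j) Y (coarsenField F K U′) − c K n j Y| ≤ C·e^{−κ₁𝓛(Y)}·θBal(n)²·L^{−4(K−n−1−j)}·(L^{−(K−1−j)})^{a}`
— [King1986] Props 3.8–3.10 / §3.4–3.5 «replacing one by one every factor» read for Bałaban's activities (43) at matched physical scale `L^{1+j−K}`
(relative lattice artefact `(ε_K/s_{1+j})^{a} = L^{−a(K−1−j)}` times the printed size (44)); located, unprinted for non-abelian d = 3.
[cite: King1986, Prop. 3.8-3.9 pp.664-665] -/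
def PolymerCauchyBgAt (C68 κ₁ a C : ℝ) : Prop :=
  ∃ c : (K n j : ℕ) → Set (Site (F.P K) 0) → ℝ,
    ∀ (K n : ℕ), n ≤ K → ∀ j : ℕ, j < K - n →
      ∀ U' : GaugeField (F.P (K + 1)) 0 (Matrix.specialUnitaryGroup (Fin 2) ℂ),
        (∀ q : Plaq (F.P (K + 1)) 0,
          GaugeGroup.dist1 (GaugeField.plaqHol U' q) ≤ C68 * θBal F.L γ b₀ p₀ n * (((F.L : ℝ) ^ (K + 1 - n))⁻¹) ^ 2) →
        ∀ Y ∈ D.Loc K (K - n) (D.triv K (K - n)) (1 + j), |D.Pterm (K + 1) (1 + (j + 1)) (refineSet F K Y) U' -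
            D.Pterm K (1 + j) Y (coarsenField F K U') - c K n j Y| ≤
            C * Real.exp (-κ₁ * D.treeLen K (1 + j) Y) * θBal F.L γ b₀ p₀ n ^ 2 *
              (((F.L : ℝ) ^ (K - n - 1 - j))⁻¹) ^ 4 * (((F.L : ℝ) ^ (K - 1 - j))⁻¹) ^ a

/-- **REAL-LIPSCHITZ DEPENDENCE OF THE LOCALISED TERMS ON THE BACKGROUND** (hypothesis schema, never asserted; the consequence of [Balaban1987RG1]
(1.18) «𝐄^{(j)}(X, …) analytic on U^c_j(X, α₀, α₁) with positive ABSOLUTE constants, |𝐄^{(j)}(X,…)| ≤ E₀exp(−κd_j(X))» by the Cauchy estimate, the radius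
being `α₁` in ξ-scaled variables, `ξ = L^{−i}` (1.13), i.e. `α₁L^{−i}` in fine group distance; tree shape `B12Eq118Analyticity263.SFAnalyticAt`): for fine
configurations `U, U′` of run `K` whose plaquettes on print's enlargement `enl K i Y` are `≤ t·L^{−2i}` (`0 ≤ t ≤ t₀`, the real window) and whose
ξ-scaled orbit distance there is at most `α₁/2`,
`|Pterm K i Y U − Pterm K i Y U′| ≤ CL·e^{−κ₁𝓛(Y)}·t²·(Lⁱ·orbitDistOn (bondsIn 0 (enl K i Y)) U U′)/α₁`. [cite: Balaban1987RG1, (1.18) p.263] -/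
def PtermLipschitz (CL κ₁ α₁ t₀ : ℝ) : Prop :=
  0 < α₁ ∧ ∀ (K i : ℕ) (Y : Set (Site (F.P K) 0)) (U U' : GaugeField (F.P K) 0 (Matrix.specialUnitaryGroup (Fin 2) ℂ)) (t : ℝ),
    0 ≤ t → t ≤ t₀ →
      (∀ q ∈ plaqsIn 0 (D.enl K i Y), GaugeGroup.dist1 (GaugeField.plaqHol U q) ≤ t * (((F.L : ℝ) ^ i)⁻¹) ^ 2) →
      (∀ q ∈ plaqsIn 0 (D.enl K i Y), GaugeGroup.dist1 (GaugeField.plaqHol U' q) ≤ t * (((F.L : ℝ) ^ i)⁻¹) ^ 2) →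
      (F.L : ℝ) ^ i * orbitDistOn F (bondsIn 0 (D.enl K i Y)) U U' ≤ α₁ / 2 → |D.Pterm K i Y U - D.Pterm K i Y U'| ≤
          CL * Real.exp (-κ₁ * D.treeLen K i Y) * t ^ 2 * ((F.L : ℝ) ^ i * orbitDistOn F (bondsIn 0 (D.enl K i Y)) U U') / α₁

/-- **THE TWO-RUN BUNDLE delivered WITH a constructed datum** (owner ruling g15-№2 (ii): the conclusion of `stub_alphaTwoRunOfLane` next to the per-run
package `T3AlphaInputsACSchemas.AlphaInputsT3AC D b₀ p₀ ε₀ C68`): at ONE decay rate `κ₁` — the printed size of the terms, summable localisation domains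
AT THAT `κ₁` ((45)), Lipschitz dependence on the background, matched domains across the two cut-offs, and the per-polymer comparison at the canonical
matched background with exponent `a` (window constant `C68` = the one of the package's `Regularity68`). [cite: Balaban1985UV3, (43)-(46) pp.266-267] -/
def TwoRun (C68 a : ℝ) : Prop :=
  ∃ κ₁ : ℝ, (∃ C : ℝ, TermSize D b₀ p₀ C κ₁) ∧ (∃ C' : ℝ, LocCover D κ₁ C') ∧
    (∃ CL α₁ t₀ : ℝ, 0 < t₀ ∧ PtermLipschitz D CL κ₁ α₁ t₀) ∧ LocMatched D ∧ (∃ C : ℝ, PolymerCauchyBgAt D b₀ p₀ C68 κ₁ a C)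

end Schemas

/-! ## §3 The route-level minimiser two-cut-off closeness (e1; no datum involved) -/

section Minimiser

variable (F : T3Family) (γ ε₀ b₀ p₀ : ℝ)

/-- **TWO-CUT-OFF CLOSENESS OF PRINT'S MINIMISERS** (hypothesis schema, never asserted; e1 of MEMO-19201-SE-anatomy; located, UNPRINTED — per run
[Balaban1985Variational] Thm 1 (8)–(10) gives existence, uniqueness modulo gauge and regularity; the abelian two-spacing template is [King1986] §4): for
every cut-off `K`, height `n ≤ K` and `θBal(n)`-small datum `V`, EVERY minimiser `U` of the Wilson action over print's regular fibre (6)(ε₀) of `V` in run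
`K` and EVERY minimiser `U′` in run `K+1` are, after one averaging step of `U′` (`coarsenField`), within gauge-orbit sup-distance
`C·θBal(n)·L^{−2(K−n)}·(L^{−(K−n)})^{a₁}` on the whole fine torus of run `K` (the minimiser's fine plaquettes are `~ θBal(n)L^{−2(K−n)}`; the relative
lattice artefact of the variational problem at comparison spacing `L^{−n}` is `(ε_K/η)^{a₁} = L^{−a₁(K−n)}`).  m-free, `D`-free; stated over ALL minimisers
(no chosen minimiser function; existence is 19200's `MinimiserStabilityRegPr` business and is imported where consumed). [cite: Balaban1985Variational, Thm 1 (8)-(10) p.279] -/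
def MinimiserCauchyAt (a₁ : ℝ) : Prop :=
  ∃ C : ℝ, ∀ (K n : ℕ) (h : n ≤ K) (V : GaugeField (F.P n) 0 (Matrix.specialUnitaryGroup (Fin 2) ℂ)),
    PlaqSmall (θBal F.L γ b₀ p₀ n) V →
      ∀ U ∈ regFibrePr F n K h ε₀ V, wilsonAction4 U = minActionRegPr F n K h ε₀ V →
        ∀ U' ∈ regFibrePr F n (K + 1) (h.trans (Nat.le_succ K)) ε₀ V,
          wilsonAction4 U' = minActionRegPr F n (K + 1) (h.trans (Nat.le_succ K)) ε₀ V →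
            orbitDistOn F Set.univ (coarsenField F K U') U ≤
              C * θBal F.L γ b₀ p₀ n * (((F.L : ℝ) ^ (K - n))⁻¹) ^ 2 * (((F.L : ℝ) ^ (K - n))⁻¹) ^ a₁

end Minimiser

end Literature.MathematicalPhysics.QuantumFieldTheory.Balaban1983to89.T3AlphaInputsACTwoRun

end
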